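import Mathlib.Analysis.SpecialFunctions.Log.Monotone
import Mathlib.Analysis.Complex.ExponentialBounds
import Literature.NumberTheory.LFunctions.DirichletLSeriesDeriv
import HarnessLib

/-!
# The tail of `∑ χ(n) log n / n`: `∑_{n ≤ N} χ(n) log n/n = −L'(1, χ) + O(B log N/N)`
# (Montgomery–Vaughan §11.2, Exercise 3(b))

Topic `Literature/NumberTheory/LFunctions`. Everything in this file is PROVED (theorems only).

For a non-principal Dirichlet character `χ` mod `q` with `|S(n)| = |∑_{m ≤ n} χ(m)| ≤ B`, Abel
summation with the weight `log n/n` and the series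
`L'(1, χ) = ∑_n S(n+1)(−log(n+1)/(n+1) + log(n+2)/(n+2))`
(`Literature.NumberTheory.LFunctions.DirichletAbel.deriv_LFunction_one_eq_tsum`) give, for
`N ≥ 2` (where `log x/x` decreases),
`|∑_{n=1}^{N} χ(n) log n/n + L'(1, χ)| ≤ 2B log(N+1)/(N+1)`
(`norm_sum_log_div_add_deriv_LFunction_one_le`); with `B = q` and with the Pólya–Vinogradov
`B = √q(1 + log q)` for primitive `χ` this is Montgomery–Vaughan's Exercise 11.2.3(b),
"`∑_{n ≤ y} χ(n) log n/n = −L'(1, χ) + O(q^{1/2} y^{−1}(log qy)²)`" (in a slightly sharper form),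
the second input of the evaluation of `∑_{n ≤ x} (1 ∗ χ)(n)/n` (loc. cit. (g)).

## References

* H. L. Montgomery, R. C. Vaughan, *Multiplicative Number Theory I*, CUP 2007, §11.2.1
  Exercise 3(b) (p. 285), §4.3 (4.33). [cite: MontgomeryVaughan2007, §11.2.1 Exercise 3(b)]
-/

noncomputable section

open Complex Filter Topology Finset

namespace Literature.NumberTheory.LFunctions.DirichletAbel

variable {q : ℕ} [NeZero q] (χ : DirichletCharacter ℂ q)

/-! ### Abel summation with a general weight -/

omit [NeZero q] in
/-- **Abel summation**: `∑_{n=1}^{N} χ(n) f(n) = S(N) f(N+1) + ∑_{n=1}^{N} S(n)(f(n) − f(n+1))`.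
[cite: MontgomeryVaughan2007, §1.3 Thm. 1.3] -/
theorem sum_apply_mul_eq_abel (f : ℕ → ℂ) (N : ℕ) :
    ∑ n ∈ range N, χ ((n + 1 : ℕ) : ZMod q) * f (n + 1) =
      partialSum χ N * f (N + 1) +
        ∑ n ∈ range N, partialSum χ (n + 1) * (f (n + 1) - f (n + 2)) := by
  induction N with
  | zero => simp
  | succ N ih =>
    rw [sum_range_succ, sum_range_succ, ih, partialSum_succ]
    push_cast
    ring_nf

/-! ### The derivative terms at `s = 1` -/

omit [NeZero q] in
/-- At `s = 1`: `deriv term_n (1) = −S(n+1)(log(n+1)/(n+1) − log(n+2)/(n+2))`. [folklore] -/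
theorem deriv_term_one (n : ℕ) :
    deriv (term χ n) 1 = -(partialSum χ (n + 1) *
      (Complex.log ((n + 1 : ℕ) : ℂ) / ((n + 1 : ℕ) : ℂ) -
        Complex.log ((n + 2 : ℕ) : ℂ) / ((n + 2 : ℕ) : ℂ))) := by
  rw [deriv_term, cpow_neg_one, cpow_neg_one, show n + 1 + 1 = n + 2 by ring]
  ring

omit [NeZero q] in
/-- `log m / m` of a natural number as a real number cast. [folklore] -/
theorem log_div_natCast (m : ℕ) :
    Complex.log (m : ℂ) / (m : ℂ) = ((Real.log m / m : ℝ) : ℂ) := by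
  rw [← Complex.natCast_log]; push_cast; rfl

/-- `log x / x` is non-negative for `x ≥ 1` and decreasing for `x ≥ 3 > e`. [folklore] -/
theorem log_div_self_sub_nonneg {x y : ℝ} (hx : 3 ≤ x) (hxy : x ≤ y) :
    0 ≤ Real.log x / x - Real.log y / y := by
  have he : Real.exp 1 ≤ 3 := by
    have := Real.exp_one_lt_d9; norm_num at this; linarith
  have h := Real.log_div_self_antitoneOn (Set.mem_Ici.mpr (he.trans hx))
    (Set.mem_Ici.mpr (he.trans (hx.trans hxy))) hxy
  linarith

omit [NeZero q] in
/-- `‖deriv term_n (1)‖ ≤ ‖S(n+1)‖ (log(n+1)/(n+1) − log(n+2)/(n+2))` once `n + 1 ≥ 3`.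
[folklore] -/
theorem norm_deriv_term_one_le {n : ℕ} (hn : 2 ≤ n) :
    ‖deriv (term χ n) 1‖ ≤ ‖partialSum χ (n + 1)‖ *
      (Real.log ((n + 1 : ℕ) : ℝ) / ((n + 1 : ℕ) : ℝ) - Real.log ((n + 2 : ℕ) : ℝ) / ((n + 2 : ℕ) : ℝ)) := by
  rw [deriv_term_one, norm_neg, norm_mul, log_div_natCast, log_div_natCast, ← Complex.ofReal_sub,
    Complex.norm_real, Real.norm_eq_abs, abs_of_nonneg]
  exact log_div_self_sub_nonneg (by exact_mod_cast (by omega : 3 ≤ n + 1))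
    (by exact_mod_cast (by omega : n + 1 ≤ n + 2))

omit [NeZero q] in
/-- **Tail of the derivative series at `s = 1`**: for `N ≥ 2` and `|S(n)| ≤ B`,
`‖∑_{n ≥ N} deriv term_n (1)‖ ≤ B log(N+1)/(N+1)` (the majorant telescopes).
[cite: MontgomeryVaughan2007, §11.2.1 Exercise 3(b)] -/
theorem norm_tsum_deriv_term_one_add_le {B : ℝ} (hB : ∀ n, ‖partialSum χ n‖ ≤ B)
    {N : ℕ} (hN : 2 ≤ N) :
    ‖∑' n : ℕ, deriv (term χ (n + N)) 1‖ ≤ B * (Real.log ((N : ℝ) + 1) / ((N : ℝ) + 1)) := by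
  have hB0 : 0 ≤ B := (norm_nonneg _).trans (hB 0)
  -- the real majorant `g n = B (f(n+N+1) − f(n+N+2))`, `f(x) = log x / x`
  set f : ℕ → ℝ := fun m => Real.log (m : ℝ) / (m : ℝ) with hf
  set g : ℕ → ℝ := fun n => B * (f (n + N + 1) - f (n + N + 2)) with hg
  have hfg : ∀ n, 0 ≤ f (n + N + 1) - f (n + N + 2) := fun n => by
    simp only [hf]
    exact log_div_self_sub_nonneg (by exact_mod_cast (by omega : 3 ≤ n + N + 1))
      (by exact_mod_cast (by omega : n + N + 1 ≤ n + N + 2))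
  have hg0 : ∀ n, 0 ≤ g n := fun n => mul_nonneg hB0 (hfg n)
  have hf0 : ∀ m : ℕ, 1 ≤ m → 0 ≤ f m := fun m hm => by
    simp only [hf]
    exact div_nonneg (Real.log_nonneg (by exact_mod_cast hm)) (Nat.cast_nonneg m)
  -- partial sums telescope
  have htel : ∀ M, ∑ n ∈ range M, g n = B * (f (N + 1) - f (M + N + 1)) := by
    intro M
    induction M with
    | zero => simp [hg]
    | succ M ih =>
      rw [sum_range_succ, ih, hg]
      simp only
      rw [show M + N + 2 = M + 1 + N + 1 by ring]
      ring
  have hbound : ∀ M, ∑ n ∈ range M, g n ≤ B * f (N + 1) := fun M => by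
    rw [htel]
    have := hf0 (M + N + 1) (by omega)
    nlinarith
  have hgs : Summable g := summable_of_sum_range_le hg0 hbound
  have hgle : ∑' n, g n ≤ B * f (N + 1) := Real.tsum_le_of_sum_range_le hg0 hbound
  -- compare the complex tail with the majorant
  have hle : ∀ n, ‖deriv (term χ (n + N)) 1‖ ≤ g n := fun n => by
    refine (norm_deriv_term_one_le χ (n := n + N) (by omega)).trans ?_
    rw [hg]
    have e1 : ((n + N + 1 : ℕ) : ℝ) = ((n + N + 1 : ℕ) : ℝ) := rfl
    simp only [hf]
    rw [show n + N + 2 = n + N + 2 from rfl]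
    exact mul_le_mul_of_nonneg_right (hB _) (hfg n)
  have key := tsum_of_norm_bounded hgs.hasSum hle
  refine key.trans (hgle.trans (le_of_eq ?_))
  simp only [hf]
  push_cast
  ring_nf

/-! ### Exercise 11.2.3(b) -/

/-- **Montgomery–Vaughan, Exercise 11.2.3(b), with a general partial-sum bound**: if `χ ≠ χ₀`,
`|S(n)| ≤ B` for all `n` and `N ≥ 2`, then
`|∑_{n=1}^{N} χ(n) log n/n + L'(1, χ)| ≤ 2B log(N+1)/(N+1)`
(Abel summation with the weight `log n/n`: `∑ χ(n) log n/n = S(N) log(N+1)/(N+1)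
− ∑_{n ≤ N} deriv term_n (1)` and `L'(1, χ) = ∑_n deriv term_n (1)`).
[cite: MontgomeryVaughan2007, §11.2.1 Exercise 3(b)] -/
theorem norm_sum_log_div_add_deriv_LFunction_one_le (hχ : χ ≠ 1) {B : ℝ}
    (hB : ∀ n, ‖partialSum χ n‖ ≤ B) {N : ℕ} (hN : 2 ≤ N) :
    ‖(∑ n ∈ range N, χ ((n + 1 : ℕ) : ZMod q) * ((Real.log ((n : ℝ) + 1) / ((n : ℝ) + 1) : ℝ) : ℂ)) +
        deriv χ.LFunction 1‖ ≤
      2 * B * (Real.log ((N : ℝ) + 1) / ((N : ℝ) + 1)) := by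
  have hB0 : 0 ≤ B := (norm_nonneg _).trans (hB 0)
  set F : ℕ → ℂ := fun m => Complex.log (m : ℂ) / (m : ℂ) with hF
  -- Abel summation with the weight `F`
  have habel := sum_apply_mul_eq_abel χ F N
  have hsum_eq : ∑ n ∈ range N, χ ((n + 1 : ℕ) : ZMod q) *
      ((Real.log ((n : ℝ) + 1) / ((n : ℝ) + 1) : ℝ) : ℂ) =
      ∑ n ∈ range N, χ ((n + 1 : ℕ) : ZMod q) * F (n + 1) := by
    refine sum_congr rfl fun n _ => ?_
    rw [hF]
    simp only
    rw [log_div_natCast]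
    push_cast
    ring_nf
  -- the Abel terms are `−deriv term_n (1)`
  have hterms : ∑ n ∈ range N, partialSum χ (n + 1) * (F (n + 1) - F (n + 2)) =
      -∑ n ∈ range N, deriv (term χ n) 1 := by
    rw [← sum_neg_distrib]
    refine sum_congr rfl fun n _ => ?_
    rw [deriv_term_one, neg_neg]
  -- the derivative series
  have h1 : (0 : ℝ) < (1 : ℂ).re := by simp
  have hL : deriv χ.LFunction 1 = (∑ n ∈ range N, deriv (term χ n) 1) +
      ∑' n : ℕ, deriv (term χ (n + N)) 1 := by
    rw [deriv_LFunction_one_eq_tsum χ hχ]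
    exact ((summable_deriv_term χ hχ h1).sum_add_tsum_nat_add N).symm
  rw [hsum_eq, habel, hterms, hL]
  have hcalc : partialSum χ N * F (N + 1) + -∑ n ∈ range N, deriv (term χ n) 1 +
      ((∑ n ∈ range N, deriv (term χ n) 1) + ∑' n : ℕ, deriv (term χ (n + N)) 1) =
      partialSum χ N * F (N + 1) + ∑' n : ℕ, deriv (term χ (n + N)) 1 := by ring
  rw [hcalc]
  refine (norm_add_le _ _).trans ?_
  have hfirst : ‖partialSum χ N * F (N + 1)‖ ≤ B * (Real.log ((N : ℝ) + 1) / ((N : ℝ) + 1)) := by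
    rw [norm_mul, hF]
    simp only
    rw [log_div_natCast, Complex.norm_real, Real.norm_eq_abs, abs_of_nonneg]
    · push_cast
      exact mul_le_mul_of_nonneg_right (hB N) (by
        have : 0 ≤ Real.log ((N : ℝ) + 1) := Real.log_nonneg (by linarith [N.cast_nonneg (α := ℝ)])
        positivity)
    · push_cast
      have : 0 ≤ Real.log ((N : ℝ) + 1) := Real.log_nonneg (by linarith [N.cast_nonneg (α := ℝ)])
      positivity
  have hsecond := norm_tsum_deriv_term_one_add_le χ hB hN
  have : 2 * B * (Real.log ((N : ℝ) + 1) / ((N : ℝ) + 1)) =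
      B * (Real.log ((N : ℝ) + 1) / ((N : ℝ) + 1)) + B * (Real.log ((N : ℝ) + 1) / ((N : ℝ) + 1)) := by
    ring
  rw [this]
  exact add_le_add hfirst hsecond

/-- Exercise 11.2.3(b) with the trivial bound `|S(N)| ≤ q` (MV (4.23); cf. MV (4.33)):
`|∑_{n=1}^{N} χ(n) log n/n + L'(1, χ)| ≤ 2q log(N+1)/(N+1)` for `χ ≠ χ₀` mod `q`, `N ≥ 2`.
[cite: MontgomeryVaughan2007, §4.3 eq. (4.33)] -/
theorem norm_sum_log_div_add_deriv_LFunction_one_le_level (hχ : χ ≠ 1) {N : ℕ} (hN : 2 ≤ N) :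
    ‖(∑ n ∈ range N, χ ((n + 1 : ℕ) : ZMod q) * ((Real.log ((n : ℝ) + 1) / ((n : ℝ) + 1) : ℝ) : ℂ)) +
        deriv χ.LFunction 1‖ ≤
      2 * q * (Real.log ((N : ℝ) + 1) / ((N : ℝ) + 1)) :=
  norm_sum_log_div_add_deriv_LFunction_one_le χ hχ (fun n => norm_partialSum_le χ hχ n) hN

/-- **Montgomery–Vaughan, Exercise 11.2.3(b)**: for `χ` primitive mod `q ≥ 2` and `N ≥ 2`,
`|∑_{n=1}^{N} χ(n) log n/n + L'(1, χ)| ≤ 2√q(1 + log q) log(N+1)/(N+1)`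
("`∑_{n ≤ y} χ(n) log n/n = −L'(1, χ) + O(q^{1/2} y^{−1} (log qy)²)`").
[cite: MontgomeryVaughan2007, §11.2.1 Exercise 3(b)] -/
theorem norm_sum_log_div_add_deriv_LFunction_one_le_polyaVinogradov (hq : 2 ≤ q)
    (hχ : χ.IsPrimitive) {N : ℕ} (hN : 2 ≤ N) :
    ‖(∑ n ∈ range N, χ ((n + 1 : ℕ) : ZMod q) * ((Real.log ((n : ℝ) + 1) / ((n : ℝ) + 1) : ℝ) : ℂ)) +
        deriv χ.LFunction 1‖ ≤
      2 * (Real.sqrt q * (1 + Real.log q)) * (Real.log ((N : ℝ) + 1) / ((N : ℝ) + 1)) := by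
  have hχ1 : χ ≠ 1 := by
    rintro rfl
    rw [DirichletCharacter.isPrimitive_def, DirichletCharacter.conductor_one] at hχ
    omega
  exact norm_sum_log_div_add_deriv_LFunction_one_le χ hχ1
    (norm_partialSum_le_polyaVinogradov χ hq hχ) hN

end Literature.NumberTheory.LFunctions.DirichletAbel
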